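import Summits.NavierStokesRegularity.NavierStokesRegularity.Theorems.StrainClockBudgetedDefs
import Summits.NavierStokesRegularity.NavierStokesRegularity.Theorems.StrainClockDoorsDefs
import HarnessLib

/-!
# Near-field parity doors D7 / D7♭ — DEFINITIONS (nsreg-p1 g33 ROUND-43/44; texts of record r43/Sketch47.lean v4)

`strainFeed = nearFeed_r + (1/4π)·farQuad_r` (CZ split of the `e`-quadrupole of the Q-field `f = ½|ω|² − |S|²` at radius `r`);
door D7 `NearFieldParityDoor` (near-field parity at almost-maximisers ⇒ continuation; via D5 `BudgetedParityDoor` + the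
time-integrated far-field budget), door D7♭ `NearFieldSubParityDoor` (smooth cutoff, velocity-level far field; via A0
`StrainRatioDoor`), the four plates Π/F/Π♭/F♭ and the analytic atoms A1/A1♭/A2/A2♭/A3/A3′ they reduce to.
HONEST FRAME: conditional doors on rung N0 (0056 helper lane); nothing here proves NS regularity. -/

noncomputable section

open MeasureTheory Set Function Filter Metric Real InnerProductSpace
open _root_.Topology
open scoped ENNReal NNReal RealInnerProductSpace ContDiff Laplacian Interval
open Literature.Analysis Literature.Analysis.FluidPDE
open Literature.Analysis.FluidPDE.VorticityDirectionDynamics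

set_option linter.dupNamespace false

namespace Summit.NavierStokesRegularity.NavierStokesRegularity.Theorems.StrainDoors

/-- the Q-FIELD DENSITY `f(t,x) = ½|ω(t,x)|² − |S(t,x)|²_F` (`= Δp`, twice the Q-criterion invariant). -/
def qDensity (u : ℝ → (EuclideanSpace ℝ (Fin 3)) → (EuclideanSpace ℝ (Fin 3))) (t : ℝ)
    (x : EuclideanSpace ℝ (Fin 3)) : ℝ :=
  (1 / 2) * ‖curl (u t) x‖ ^ 2 - strainNormSq u t x

/-- the (un-normalised) deviatoric dipole–dipole KERNEL along `e`: `K_e(y) = (3⟪y,e⟫² − |y|²)/|y|⁵`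
(`= (3(ŷ·e)² − 1)/|y|³`; zero spherical mean; `|K_e(y)| ≤ 2/|y|³` for a unit `e`; junk `0` at `y = 0`). -/
def quadKernel (e y : EuclideanSpace ℝ (Fin 3)) : ℝ :=
  (3 * ⟪y, e⟫ ^ 2 - ‖y‖ ^ 2) / ‖y‖ ^ 5

/-- the LOCAL part of the strain feed: `|S|²/3 + (|ω|² − 3⟪ω,e⟫²)/12` (`= ¼(|ω|²−ω_e²) − Δp/3` once `Δp = f`). -/
def localFeed (u : ℝ → (EuclideanSpace ℝ (Fin 3)) → (EuclideanSpace ℝ (Fin 3))) (t : ℝ)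
    (x e : EuclideanSpace ℝ (Fin 3)) : ℝ :=
  (1 / 3) * strainNormSq u t x + (‖curl (u t) x‖ ^ 2 - 3 * ⟪curl (u t) x, e⟫ ^ 2) / 12

/-- the NEAR-FIELD `e`-quadrupole of the Q-field at scale `r` (principal value realised by subtracting `f(x)`, legitimate
because `K_e` has zero mean on every sphere): `∫_{|y|<r} K_e(y) (f(x+y) − f(x)) dy`. -/
def nearQuad (r : ℝ) (u : ℝ → (EuclideanSpace ℝ (Fin 3)) → (EuclideanSpace ℝ (Fin 3))) (t : ℝ)
    (x e : EuclideanSpace ℝ (Fin 3)) : ℝ :=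
  ∫ y in ball (0 : EuclideanSpace ℝ (Fin 3)) r, quadKernel e y * (qDensity u t (x + y) - qDensity u t x)

/-- the FAR-FIELD `e`-quadrupole of the Q-field beyond scale `r`: `∫_{|y|≥r} K_e(y) f(x+y) dy`. -/
def farQuad (r : ℝ) (u : ℝ → (EuclideanSpace ℝ (Fin 3)) → (EuclideanSpace ℝ (Fin 3))) (t : ℝ)
    (x e : EuclideanSpace ℝ (Fin 3)) : ℝ :=
  ∫ y in (ball (0 : EuclideanSpace ℝ (Fin 3)) r)ᶜ, quadKernel e y * qDensity u t (x + y)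

/-- the NEAR-FIELD FEED at scale `r`: `N_r = |S|²/3 + (|ω|²−3ω_e²)/12 + (1/4π)·nearQuad_r` — PRESSURE-FREE and determined by
`∇u` in the ball `B(x,r)` alone. -/
def nearFeed (r : ℝ) (u : ℝ → (EuclideanSpace ℝ (Fin 3)) → (EuclideanSpace ℝ (Fin 3))) (t : ℝ)
    (x e : EuclideanSpace ℝ (Fin 3)) : ℝ :=
  localFeed u t x e + (1 / (4 * π)) * nearQuad r u t x e

/-- ★ door D7 «NearFieldParityDoor» (crux-grade text; forward; S38's Sobolev frame = D5's). Classical unforced solution on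
`[0,T)` with bounded Sobolev norms on every `[0,T'']`, `T'' < T`. IF for some scale `r > 0`, level `l₀ > 0` and `δ ∈ (0,1)`:
at every `δ`-almost strain maximiser `(x̄,ē)` on `[t₀,T)` charged above `l₀`, the NEAR-FIELD FEED is at most PARITY,
`N_r(t,x̄,ē) ≤ q²` (`q = ⟪∇u ē,ē⟫`), THEN `u` extends past `T`. Everything beyond radius `r` is paid by the energy class
(plates Π, F + door D5). -/
def NearFieldParityDoor : Prop :=
  ∀ (ν T t₀ l₀ δ r : ℝ), 0 < ν → 0 ≤ t₀ → t₀ < T → 0 < l₀ → 0 < δ → δ < 1 → 0 < r →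
    ∀ (u : ℝ → (EuclideanSpace ℝ (Fin 3)) → (EuclideanSpace ℝ (Fin 3)))
      (p : ℝ → (EuclideanSpace ℝ (Fin 3)) → ℝ),
      IsClassicalNSSolutionOn (Ico 0 T) ν 0 u p →
      (∀ T'' < T, HasBoundedSobolevNormsOn (Icc 0 T'') u) →
      (∀ t ∈ Ico t₀ T, ∀ (x e : EuclideanSpace ℝ (Fin 3)), IsStrainAlmostArgmax δ u t x e →
        l₀ < strainQuad u t x e → nearFeed r u t x e ≤ strainQuad u t x e ^ 2) →
      HasSobolevExtensionPast ν u T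

/-- plate Π «PressureHessianSplits» (TRUE analysis fact about the frame, S/M-lane): for the frame's classical Sobolev solution
the pressure is Newtonian up to a constant (the equation pins `∇p`; Liouville), `Δp = f`, and the Calderón–Zygmund second-
derivative formula gives, for every unit `e`, scale `r > 0` and point `x`:
`strainFeed = nearFeed_r + (1/4π)·farQuad_r` (local algebra `p_ee = Π_ee + f/3` + the PV formula for `Π_ee` split at `r`). -/
def PressureHessianSplits : Prop :=
  ∀ (ν T : ℝ) (u : ℝ → (EuclideanSpace ℝ (Fin 3)) → (EuclideanSpace ℝ (Fin 3)))
    (p : ℝ → (EuclideanSpace ℝ (Fin 3)) → ℝ), 0 < ν →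
    IsClassicalNSSolutionOn (Ico 0 T) ν 0 u p →
    (∀ T'' < T, HasBoundedSobolevNormsOn (Icc 0 T'') u) →
    ∀ t ∈ Ico 0 T, ∀ r > 0, ∀ (x e : EuclideanSpace ℝ (Fin 3)), ‖e‖ = 1 →
      strainFeed u p t x e = nearFeed r u t x e + (1 / (4 * π)) * farQuad r u t x e

/-- plate F «FarFieldBudget» (TRUE analysis fact about the frame, S/M-lane): the far-field quadrupole has an A PRIORI
INTEGRABLE bound — `|K_e| ≤ 2/r³` beyond `r`, `|f| ≤ |∇u|²_F` pointwise, so `(1/4π)|farQuad_r| ≤ ‖∇u(t)‖²_{L²}/(2πr³) =: b(t)`,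
and the energy inequality gives the primitive `Φ(t) = ∫_{t₀}^{t} b ≤ ‖u(t₀)‖²_{L²}/(4πν r³) =: β` with `Φ′ = b` (b continuous
for classical Sobolev solutions). Stated in exactly the shape door D5 consumes. -/
def FarFieldBudget : Prop :=
  ∀ (ν T t₀ r : ℝ) (u : ℝ → (EuclideanSpace ℝ (Fin 3)) → (EuclideanSpace ℝ (Fin 3)))
    (p : ℝ → (EuclideanSpace ℝ (Fin 3)) → ℝ), 0 < ν → 0 ≤ t₀ → t₀ < T → 0 < r →
    IsClassicalNSSolutionOn (Ico 0 T) ν 0 u p →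
    (∀ T'' < T, HasBoundedSobolevNormsOn (Icc 0 T'') u) →
    ∃ (β : ℝ) (Φ b : ℝ → ℝ), Φ t₀ = 0 ∧ (∀ t ∈ Ico t₀ T, 0 ≤ Φ t ∧ Φ t ≤ β ∧ HasDerivAt Φ (b t) t) ∧
      ∀ t ∈ Ico t₀ T, ∀ (x e : EuclideanSpace ℝ (Fin 3)), ‖e‖ = 1 →
        (1 / (4 * π)) * |farQuad r u t x e| ≤ b t

/-- smooth radial cutoff at scale `r`: `χ_r(y) = smoothTransition(2 − |y|/r)` (`= 1` for `|y| ≤ r`, `= 0` for `|y| ≥ 2r`). -/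
def radialCutoff (r : ℝ) (y : EuclideanSpace ℝ (Fin 3)) : ℝ :=
  Real.smoothTransition (2 - ‖y‖ / r)

/-- smoothly truncated NEAR-FIELD quadrupole (reads `f` on `B(x,2r)` only). -/
def nearQuadS (r : ℝ) (u : ℝ → (EuclideanSpace ℝ (Fin 3)) → (EuclideanSpace ℝ (Fin 3))) (t : ℝ)
    (x e : EuclideanSpace ℝ (Fin 3)) : ℝ :=
  ∫ y, radialCutoff r y * quadKernel e y * (qDensity u t (x + y) - qDensity u t x)

/-- smoothly truncated FAR-FIELD quadrupole. -/
def farQuadS (r : ℝ) (u : ℝ → (EuclideanSpace ℝ (Fin 3)) → (EuclideanSpace ℝ (Fin 3))) (t : ℝ)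
    (x e : EuclideanSpace ℝ (Fin 3)) : ℝ :=
  ∫ y, (1 - radialCutoff r y) * quadKernel e y * qDensity u t (x + y)

/-- smoothly truncated NEAR-FIELD FEED `N^χ_r = localFeed + (1/4π)·nearQuadS_r`. -/
def nearFeedS (r : ℝ) (u : ℝ → (EuclideanSpace ℝ (Fin 3)) → (EuclideanSpace ℝ (Fin 3))) (t : ℝ)
    (x e : EuclideanSpace ℝ (Fin 3)) : ℝ :=
  localFeed u t x e + (1 / (4 * π)) * nearQuadS r u t x e

/-- ★ door D7♭ «NearFieldSubParityDoor» (crux-grade text; forward; S38 Sobolev frame = A0's). IF for some scale `r > 0`, ratio `c < 1`,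
level `l₀ ≥ 0`, `δ ∈ (0,1)`: at every `δ`-almost strain maximiser on `[t₀,T)` charged above `l₀` the smoothly truncated near-field feed is
SUB-parity, `N^χ_r ≤ c·q²`, THEN `u` extends past `T`. (The far field costs a CONSTANT `B = C_χ‖u(t₀)‖₂²/r⁵`, absorbed above an explicit level.) -/
def NearFieldSubParityDoor : Prop :=
  ∀ (ν T t₀ l₀ c δ r : ℝ), 0 < ν → 0 ≤ t₀ → t₀ < T → 0 ≤ l₀ → c < 1 → 0 < δ → δ < 1 → 0 < r →
    ∀ (u : ℝ → (EuclideanSpace ℝ (Fin 3)) → (EuclideanSpace ℝ (Fin 3)))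
      (p : ℝ → (EuclideanSpace ℝ (Fin 3)) → ℝ),
      IsClassicalNSSolutionOn (Ico 0 T) ν 0 u p →
      (∀ T'' < T, HasBoundedSobolevNormsOn (Icc 0 T'') u) →
      (∀ t ∈ Ico t₀ T, ∀ (x e : EuclideanSpace ℝ (Fin 3)), IsStrainAlmostArgmax δ u t x e →
        l₀ < strainQuad u t x e → nearFeedS r u t x e ≤ c * strainQuad u t x e ^ 2) →
      HasSobolevExtensionPast ν u T

/-- plate Π♭ «PressureHessianSplitsSmooth» (TRUE, S/M-lane; as plate Π with the smooth cutoff). -/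
def PressureHessianSplitsSmooth : Prop :=
  ∀ (ν T : ℝ) (u : ℝ → (EuclideanSpace ℝ (Fin 3)) → (EuclideanSpace ℝ (Fin 3)))
    (p : ℝ → (EuclideanSpace ℝ (Fin 3)) → ℝ), 0 < ν →
    IsClassicalNSSolutionOn (Ico 0 T) ν 0 u p →
    (∀ T'' < T, HasBoundedSobolevNormsOn (Icc 0 T'') u) →
    ∀ t ∈ Ico 0 T, ∀ r > 0, ∀ (x e : EuclideanSpace ℝ (Fin 3)), ‖e‖ = 1 →
      strainFeed u p t x e = nearFeedS r u t x e + (1 / (4 * π)) * farQuadS r u t x e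

/-- plate F♭ «FarFieldUniformBound» (TRUE, S/M-lane): two integrations by parts onto `u ⊗ u`, `|∂²[(1−χ_r)K_e]| ≤ C_χ|y|⁻⁵`, and the
energy inequality give `(1/4π)|farQuadS_r| ≤ C_χ‖u(t₀)‖²_{L²}/r⁵ =: B` for all `t ∈ [t₀,T)`, `x`, unit `e`. -/
def FarFieldUniformBound : Prop :=
  ∀ (ν T t₀ r : ℝ) (u : ℝ → (EuclideanSpace ℝ (Fin 3)) → (EuclideanSpace ℝ (Fin 3)))
    (p : ℝ → (EuclideanSpace ℝ (Fin 3)) → ℝ), 0 < ν → 0 ≤ t₀ → t₀ < T → 0 < r →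
    IsClassicalNSSolutionOn (Ico 0 T) ν 0 u p →
    (∀ T'' < T, HasBoundedSobolevNormsOn (Icc 0 T'') u) →
    ∃ B : ℝ, 0 ≤ B ∧ ∀ t ∈ Ico t₀ T, ∀ (x e : EuclideanSpace ℝ (Fin 3)), ‖e‖ = 1 →
      (1 / (4 * π)) * |farQuadS r u t x e| ≤ B

/-- atom A1 «NewtonHessianFormula». -/
def NewtonHessianFormula : Prop :=
  ∀ (ν T : ℝ) (u : ℝ → (EuclideanSpace ℝ (Fin 3)) → (EuclideanSpace ℝ (Fin 3)))
    (p : ℝ → (EuclideanSpace ℝ (Fin 3)) → ℝ), 0 < ν →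
    IsClassicalNSSolutionOn (Ico 0 T) ν 0 u p →
    (∀ T'' < T, HasBoundedSobolevNormsOn (Icc 0 T'') u) →
    ∀ t ∈ Ico 0 T, ∀ r > 0, ∀ (x e : EuclideanSpace ℝ (Fin 3)), ‖e‖ = 1 →
      pressureHess p t x e = qDensity u t x / 3 - (1 / (4 * π)) * (nearQuad r u t x e + farQuad r u t x e)

/-- atom A1♭ «NewtonHessianFormulaSmooth». -/
def NewtonHessianFormulaSmooth : Prop :=
  ∀ (ν T : ℝ) (u : ℝ → (EuclideanSpace ℝ (Fin 3)) → (EuclideanSpace ℝ (Fin 3)))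
    (p : ℝ → (EuclideanSpace ℝ (Fin 3)) → ℝ), 0 < ν →
    IsClassicalNSSolutionOn (Ico 0 T) ν 0 u p →
    (∀ T'' < T, HasBoundedSobolevNormsOn (Icc 0 T'') u) →
    ∀ t ∈ Ico 0 T, ∀ r > 0, ∀ (x e : EuclideanSpace ℝ (Fin 3)), ‖e‖ = 1 →
      pressureHess p t x e = qDensity u t x / 3 - (1 / (4 * π)) * (nearQuadS r u t x e + farQuadS r u t x e)

/-- atom A2 «FarFieldL1Bound». -/
def FarFieldL1Bound : Prop :=
  ∀ (ν T : ℝ) (u : ℝ → (EuclideanSpace ℝ (Fin 3)) → (EuclideanSpace ℝ (Fin 3)))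
    (p : ℝ → (EuclideanSpace ℝ (Fin 3)) → ℝ), 0 < ν →
    IsClassicalNSSolutionOn (Ico 0 T) ν 0 u p →
    (∀ T'' < T, HasBoundedSobolevNormsOn (Icc 0 T'') u) →
    ∀ t ∈ Ico 0 T, ∀ r > 0, ∀ (x e : EuclideanSpace ℝ (Fin 3)), ‖e‖ = 1 →
      |farQuad r u t x e| ≤ 2 / r ^ 3 * VectorCalculus.gradNormSq (u t)

/-- atom A2♭ «FarFieldEnergyBound» (one universal constant `C = C_χ`). -/
def FarFieldEnergyBound : Prop :=
  ∃ C : ℝ, 0 ≤ C ∧ ∀ (ν T : ℝ) (u : ℝ → (EuclideanSpace ℝ (Fin 3)) → (EuclideanSpace ℝ (Fin 3)))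
    (p : ℝ → (EuclideanSpace ℝ (Fin 3)) → ℝ), 0 < ν →
    IsClassicalNSSolutionOn (Ico 0 T) ν 0 u p →
    (∀ T'' < T, HasBoundedSobolevNormsOn (Icc 0 T'') u) →
    ∀ t ∈ Ico 0 T, ∀ r > 0, ∀ (x e : EuclideanSpace ℝ (Fin 3)), ‖e‖ = 1 →
      |farQuadS r u t x e| ≤ C / r ^ 5 * VectorCalculus.kineticEnergy (u t)

/-- atom A3 «DissipationPrimitive» (energy identity ⇒ `∫_{t₀}^{t}‖∇u‖₂² = (E(t₀) − E(t))/ν ≤ E(t₀)/ν`). -/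
def DissipationPrimitive : Prop :=
  ∀ (ν T t₀ : ℝ) (u : ℝ → (EuclideanSpace ℝ (Fin 3)) → (EuclideanSpace ℝ (Fin 3)))
    (p : ℝ → (EuclideanSpace ℝ (Fin 3)) → ℝ), 0 < ν → 0 ≤ t₀ → t₀ < T →
    IsClassicalNSSolutionOn (Ico 0 T) ν 0 u p →
    (∀ T'' < T, HasBoundedSobolevNormsOn (Icc 0 T'') u) →
    ∃ Φ : ℝ → ℝ, Φ t₀ = 0 ∧ ∀ t ∈ Ico t₀ T,
      0 ≤ Φ t ∧ Φ t ≤ VectorCalculus.kineticEnergy (u t₀) / ν ∧ HasDerivAt Φ (VectorCalculus.gradNormSq (u t)) t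

/-- atom A3′ «EnergyNonIncreasing». -/
def EnergyNonIncreasing : Prop :=
  ∀ (ν T : ℝ) (u : ℝ → (EuclideanSpace ℝ (Fin 3)) → (EuclideanSpace ℝ (Fin 3)))
    (p : ℝ → (EuclideanSpace ℝ (Fin 3)) → ℝ), 0 < ν →
    IsClassicalNSSolutionOn (Ico 0 T) ν 0 u p →
    (∀ T'' < T, HasBoundedSobolevNormsOn (Icc 0 T'') u) →
    ∀ t₀ t, 0 ≤ t₀ → t₀ ≤ t → t < T → VectorCalculus.kineticEnergy (u t) ≤ VectorCalculus.kineticEnergy (u t₀)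

/-! ## APPENDED (ns-s29-p2 g5, from r43/Sketch47.lean v5 a42ef461fa5ce9bc via r44 Defs 825c9cd505198f4f): two further atoms -/

/-! ## §9 ATOM A3 REDUCED TO PURE KINEMATICS — the dissipation budget from continuity of `t ↦ ‖∇u(t)‖₂²` alone
(Tao 2013 Lemma 8.1 `tao_finite_energy_smooth_energy_bound_holds` by name + FTC); D7 ← A1 ∧ A3a. -/

/-- atom A3⁺ «DissipationBudget»: A3 with an unspecified budget `β` (all that plate F / D5 use). -/
def DissipationBudget : Prop :=
  ∀ (ν T t₀ : ℝ) (u : ℝ → (EuclideanSpace ℝ (Fin 3)) → (EuclideanSpace ℝ (Fin 3)))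
    (p : ℝ → (EuclideanSpace ℝ (Fin 3)) → ℝ), 0 < ν → 0 ≤ t₀ → t₀ < T →
    IsClassicalNSSolutionOn (Ico 0 T) ν 0 u p →
    (∀ T'' < T, HasBoundedSobolevNormsOn (Icc 0 T'') u) →
    ∃ (β : ℝ) (Φ : ℝ → ℝ), Φ t₀ = 0 ∧ ∀ t ∈ Ico t₀ T,
      0 ≤ Φ t ∧ Φ t ≤ β ∧ HasDerivAt Φ (VectorCalculus.gradNormSq (u t)) t

/-- atom A3a «GradNormSqContinuousOn» (pure kinematics of the frame: `t ↦ ‖∇u(t)‖₂²` is continuous on `[0,T)`). -/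
def GradNormSqContinuousOn : Prop :=
  ∀ (ν T : ℝ) (u : ℝ → (EuclideanSpace ℝ (Fin 3)) → (EuclideanSpace ℝ (Fin 3)))
    (p : ℝ → (EuclideanSpace ℝ (Fin 3)) → ℝ), 0 < ν →
    IsClassicalNSSolutionOn (Ico 0 T) ν 0 u p →
    (∀ T'' < T, HasBoundedSobolevNormsOn (Icc 0 T'') u) →
    ContinuousOn (fun t => VectorCalculus.gradNormSq (u t)) (Ico 0 T)

end Summit.NavierStokesRegularity.NavierStokesRegularity.Theorems.StrainDoors
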